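import Literature.Analysis.FluidPDE.ZerothLaw
import HarnessLib

/-!
# Doering–Foias a-priori bounds for body-forced turbulence

Named facts (statements only, `def … : Prop`) recording the two a-priori estimates behind the
Doering–Foias upper bound `ε ≤ c₁ U³/ℓ + c₂ ν U²/ℓ²` (`Literature.Analysis.FluidPDE.doering_foias_bound`, turb.S05,
`Literature.Analysis.FluidPDE.ZerothLaw`) for Leray–Hopf solutions of the incompressible
Navier–Stokes equations on `T³` driven by a steady force `f(x) = F Φ(x/ℓ)`, together with the
elementary consequences requested by the routes *Correlation #4* and *Ensemble #4*:

* `Turb.DoeringFoias2002_dissipation_le_power`: `ε ≤ ⟨f·u⟩` (power balance as an inequality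
  for weak solutions; Cheskidov–Doering–Petrov, eq. (11) and the remark following it).
* `Turb.DoeringFoias2002_power_le`: `⟨f·u⟩ ≤ F U` (Cauchy–Schwarz in space, Jensen in time;
  Cheskidov–Doering–Petrov, eq. (17) with `α = 0`; Doering–Foias 2002, §2).
* `Turb.DoeringFoias2002_amplitude_le`: `F ≤ a U²/ℓ + b ν U/ℓ²` with `a, b` depending only on
  the shape `Φ` (momentum equation tested against a smooth multiplier `ψ(x/ℓ)`;
  Cheskidov–Doering–Petrov, eqs. (18)–(19); Doering–Foias 2002, §3).

Proved consequences (pure algebra on top of the named facts):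

* `Turb.DoeringFoias2002_amplitude_le.scale_mul_abs_le`: for `ν ≤ U ℓ` (i.e. `Re ≥ 1`),
  `ℓ F ≤ (a + b) U²` — the lower bound `U² ≳ F ℓ` on the r.m.s. velocity.
* `Turb.DoeringFoias2002_amplitude_le.grashof_le`: `Gr ≤ a Re² + b Re` with the Grashof number
  `Gr = F ℓ³/ν²` (`Turb.grashofNumber`; Doering–Foias 2002, abstract and §3), whence
  `Re ≳ Gr^{1/2}` for `Re ≥ 1` (`grashof_le_reynolds_sq`).
* `Turb.doering_foias_bound_of`: the three facts (and regularity of the rescaled force,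
  `ForcingShape.force_regular`) imply `Turb.doering_foias_bound` with `c₁ = a`, `c₂ = b`:
  `ε ≤ ⟨f·u⟩ ≤ F U ≤ a U³/ℓ + b ν U²/ℓ²` (Cheskidov–Doering–Petrov, eq. (20) with `α = 0`;
  Doering–Foias 2002, abstract).

## Conventions

All averages are the `limsup` long-time averages of `TurbWave0` (`Turb.longTimeAvgSup`), as in
`ZerothLaw`; Cheskidov–Doering–Petrov (p. 6) note that with `lim sup` in place of `lim` "the
estimates we derive are fully applicable to weak solutions". `U = Turb.rmsVelocity longTimeAvgSup u`,
`ε = Turb.meanDissipation ν u` (spectral, ε-form), `ℓ = 1/n` and `f = ForcingShape.force Φ n F`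
exactly as in `Turb.doering_foias_bound`. The sources take the amplitude `F ≥ 0` (it is the `L²`
norm of `f` for the normalised shape, `‖Φ‖₂ = 1`); here `F : ℝ` is arbitrary and the bounds are
stated for `|F|` — the case `F < 0` is the source applied to the shape `-Φ` with multiplier `-ψ`,
which has the same constants. The mean injected power is `Turb.meanPower f u = ⟨∫ ⟪f, u(t)⟫⟩`.
Cheskidov–Doering–Petrov (p. 4) normalise force *and data* to spatial mean zero "without loss of
generality"; as in `Turb.doering_foias_bound`, no mean-zero hypothesis is put on the datum `u₀`
here (for a mean-zero force the mean velocity `m₀ = ∫ u₀` is conserved, `⟨f·u⟩` and `ε` only see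
`u - m₀`, `U² = U_{u-m₀}² + |m₀|²`, and the multiplier argument for the amplitude bound does not
use `∫ u = 0`), whereas the mean-zero hypothesis on `f` is kept (it is needed: a force with
non-zero mean accelerates the mean flow linearly in time and all `limsup` averages degenerate).

## Mathlib search

Mathlib (this pin) has no Navier–Stokes / energy-dissipation notions (see `ZerothLaw`); nothing
to reuse beyond `Real.sqrt`, `abs`, `Filter.limsup` (through `TurbWave0`).

## References

* C. R. Doering, C. Foias, *Energy dissipation in body-forced turbulence*, J. Fluid Mech. 467
  (2002), 289–306, §§2–3 and abstract (`ε ≤ c₁ ν U²/ℓ² + c₂ U³/ℓ`; `Gr = F ℓ³/ν²`).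
  [paywalled; statements checked against the open follow-up below, which reproduces the
  argument verbatim for `α = 0`.]
* A. Cheskidov, C. R. Doering, N. P. Petrov, *Energy dissipation in fractal-forced flow*,
  J. Math. Phys. 48 (2007) 065208, arXiv:physics/0607280, §II eqs. (7)–(11), §III eqs. (15)–(21).
-/

open MeasureTheory Filter Topology Set
open scoped ENNReal NNReal RealInnerProductSpace

noncomputable section

namespace Literature.Analysis.FluidPDE

/-- The physical flat unit torus `T³ = (ℝ/ℤ)³` (local notation). -/
local notation "𝕋³" => UnitAddTorus (Fin 3)
/-- Velocity values on `T³` (local notation). -/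
local notation "E³" => EuclideanSpace ℝ (Fin 3)

variable {d : Type*} [Fintype d]

/-! ### Mean injected power and the Grashof number -/

/-- The long-time mean power injected by a steady body force,
`⟨f·u⟩ = limsup_{T→∞} T⁻¹ ∫₀ᵀ ∫_{T^d} f(x)·u(t,x) dx dt` (Cheskidov–Doering–Petrov, eqs. (7), (8),
(11); unit torus, so no volume normalisation). Junk: the inner space integral is a Bochner
integral (`0` when `x ↦ ⟪f x, u t x⟫` is not integrable) and the outer average is the `limsup`
average of `TurbWave0` (junk `Real.sSup` value when the running means are unbounded). [cite: CheskidovDoeringPetrov2006, eq. (11)] -/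
def meanPower (f : UnitAddTorus d → EuclideanSpace ℝ d)
    (u : ℝ → UnitAddTorus d → EuclideanSpace ℝ d) : ℝ :=
  longTimeAvgSup fun t => ∫ x, ⟪f x, u t x⟫

/-- Unfolding the mean power (definitional). [folklore] -/
theorem meanPower_eq (f : UnitAddTorus d → EuclideanSpace ℝ d)
    (u : ℝ → UnitAddTorus d → EuclideanSpace ℝ d) :
    meanPower f u = longTimeAvgSup fun t => ∫ x, ⟪f x, u t x⟫ :=
  rfl

/-- The running mean of the zero function vanishes. [folklore] -/
@[simp] theorem timeMean_zero_fun : timeMean (fun _ => (0 : ℝ)) = fun _ => 0 := by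
  funext T
  simp [timeMean]

/-- The `limsup` long-time average of the zero function vanishes. [folklore] -/
@[simp] theorem longTimeAvgSup_zero_fun : longTimeAvgSup (fun _ => (0 : ℝ)) = 0 := by
  simp [longTimeAvgSup]

/-- The zero force injects no power. [folklore] -/
@[simp] theorem meanPower_zero (u : ℝ → UnitAddTorus d → EuclideanSpace ℝ d) :
    meanPower (0 : UnitAddTorus d → EuclideanSpace ℝ d) u = 0 := by
  simp [meanPower]

/-- The **Grashof number** `Gr = F ℓ³/ν²` of a body force of amplitude `F` and (longest) length
scale `ℓ` at kinematic viscosity `ν` (Doering–Foias 2002, abstract). Junk value `0` for `ν = 0`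
(division convention). [cite: DoeringFoias2002, abstract] -/
def grashofNumber (F ℓ ν : ℝ) : ℝ :=
  F * ℓ ^ 3 / ν ^ 2

/-- `Gr · ν² = F ℓ³` for `ν ≠ 0`. [folklore] -/
theorem grashofNumber_mul_sq {ν : ℝ} (hν : ν ≠ 0) (F ℓ : ℝ) :
    grashofNumber F ℓ ν * ν ^ 2 = F * ℓ ^ 3 := by
  unfold grashofNumber
  field_simp

/-- The identity behind `Re² ≳ Gr`: `Re² = (U² · ℓ²)/ν²`, so `Gr / Re² = F ℓ / U²`
(`ν, U, ℓ ≠ 0`). [folklore] -/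
theorem grashofNumber_div_reynoldsNumber_sq {F ℓ ν U : ℝ} (hν : ν ≠ 0) (hU : U ≠ 0)
    (hℓ : ℓ ≠ 0) :
    grashofNumber F ℓ ν / reynoldsNumber U ℓ ν ^ 2 = F * ℓ / U ^ 2 := by
  unfold grashofNumber reynoldsNumber
  field_simp

/-! ### The named facts -/

section Facts

/-- **Power balance inequality for Leray–Hopf solutions** (Cheskidov–Doering–Petrov 2007,
eq. (11) and the sentence following it, citing Constantin–Foias, Doering–Gibbon, Foias–Manley–
Rosa–Temam; Doering–Foias 2002, §2). For the 3-d incompressible Navier–Stokes equations on the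
periodic box driven by a time-independent, square-integrable, mean-zero body force `f`, every
(Leray–Hopf) weak solution satisfies `ε ≤ ⟨f·u⟩`: the long-time mean viscous dissipation rate
`ε = ⟨ν‖∇u‖₂²⟩` is at most the long-time mean injected power (with equality for solutions
satisfying the energy *equality*, e.g. regular ones); averages are `limsup` averages, for which
"the estimates … are fully applicable to weak solutions" (loc. cit., p. 6). Stated on the unit
torus `T³` with `Torus.IsGlobalLerayHopf`, `Turb.meanDissipation` (spectral, ε-form) and
`Turb.meanPower`. [cite: CheskidovDoeringPetrov2006, eq. (11)] -/
def DoeringFoias2002_dissipation_le_power : Prop :=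
  ∀ ⦃ν : ℝ⦄, 0 < ν → ∀ ⦃f : 𝕋³ → E³⦄, MemLp f 2 volume → FunctionSpaces.Torus.HasZeroMean f →
    ∀ (u₀ : 𝕋³ → E³) (u : ℝ → 𝕋³ → E³), Torus.IsGlobalLerayHopf ν (fun _ => f) u₀ u →
      meanDissipation ν u ≤ meanPower f u

/-- **Doering–Foias power bound `⟨f·u⟩ ≤ F U`** (Cheskidov–Doering–Petrov 2007, eq. (17) with
`α = 0`, i.e. the first line of the display before (17): `|⟨f·u⟩| ≤ ‖f‖₂ ⟨‖u‖₂⟩ ≤ F U` by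
Cauchy–Schwarz in space and Jensen/Cauchy–Schwarz in time; Doering–Foias 2002, §2). For the steady
force `f(x) = F Φ(x/ℓ)` with `L²`-normalised shape `Φ` (`Turb.ForcingShape`, `‖Φ‖₂ = 1`, so
`‖f‖₂ = |F|`), scale `ℓ = 1/n`, and every global Leray–Hopf solution `u` on `T³`:
`⟨f·u⟩ ≤ |F| U` with `U = ⟨‖u‖₂²⟩^{1/2}` (`limsup` averages). The source has `F ≥ 0`; `|F|`
covers `F < 0` by replacing `Φ` with `-Φ`. [cite: CheskidovDoeringPetrov2006, eq. (17)] -/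
def DoeringFoias2002_power_le : Prop :=
  ∀ (Φ : ForcingShape (Fin 3)) ⦃ν : ℝ⦄, 0 < ν → ∀ ⦃n : ℕ⦄, 0 < n →
    ∀ (F : ℝ) (u₀ : 𝕋³ → E³) (u : ℝ → 𝕋³ → E³),
      Torus.IsGlobalLerayHopf ν (fun _ => Φ.force n F) u₀ u →
        meanPower (Φ.force n F) u ≤ |F| * rmsVelocity longTimeAvgSup u

/-- **Doering–Foias bound on the forcing amplitude** (Cheskidov–Doering–Petrov 2007, eqs.
(18)–(19) with (21); Doering–Foias 2002, §3). Fix a forcing shape `Φ` on the unit 3-torus. There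
are constants `a, b > 0` depending only on `Φ` — namely `a = ‖∇̃ψ‖_∞/⟨Φ·ψ⟩` and
`b = ‖ψ‖_{H²}/⟨Φ·ψ⟩` for any smooth divergence-free multiplier `ψ` with `⟨Φ·ψ⟩ > 0`, e.g. a
Galerkin truncation of `Φ` — such that for every viscosity `ν > 0`, scale `ℓ = 1/n` (`n ∈ ℕ⁺`),
amplitude `F` and every global Leray–Hopf solution `u` of the Navier–Stokes equations on `T³`
forced by `f(x) = F Φ(x/ℓ)`,
`F ≤ a U²/ℓ + b ν U/ℓ²`, `U = ⟨‖u‖₂²⟩^{1/2}`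
(test the momentum equation against `ψ(x/ℓ)`, integrate by parts, time-average — the
time-derivative term averages to `0` since `‖u(t)‖₂` is bounded — and apply Hölder and
Cauchy–Schwarz: `F⟨Φ·ψ⟩ = -⟨u·(∇ψ)·u⟩ - ν⟨u·Δψ⟩ ≤ ‖∇ψ‖_∞⟨‖u‖²⟩ + ν‖Δψ‖₂⟨‖u‖⟩`). Stated for
`|F|` (`F < 0`: apply the source to `-Φ`, `-ψ`, same constants); `limsup` averages. [cite: CheskidovDoeringPetrov2006, eqs. (18)–(19)] -/
def DoeringFoias2002_amplitude_le : Prop :=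
  ∀ (Φ : ForcingShape (Fin 3)), ∃ a b : ℝ, 0 < a ∧ 0 < b ∧
    ∀ ⦃ν : ℝ⦄, 0 < ν → ∀ ⦃n : ℕ⦄, 0 < n →
      ∀ (F : ℝ) (u₀ : 𝕋³ → E³) (u : ℝ → 𝕋³ → E³),
        Torus.IsGlobalLerayHopf ν (fun _ => Φ.force n F) u₀ u →
          |F| ≤ a * rmsVelocity longTimeAvgSup u ^ 2 / (n : ℝ)⁻¹ +
            b * ν * rmsVelocity longTimeAvgSup u / (n : ℝ)⁻¹ ^ 2

end Facts

/-! ### Consequences -/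

section Consequences

/-- Elementary algebra behind the lower bound on `U`: if `0 < ℓ`, `0 ≤ U`, `ν ≤ U ℓ` and
`F ≤ a U²/ℓ + b ν U/ℓ²` with `b ≥ 0`, then `ℓ F ≤ (a + b) U²`. [folklore] -/
theorem scale_mul_le_of_amplitude_le {F a b ν U ℓ : ℝ} (hℓ : 0 < ℓ) (hU : 0 ≤ U) (hb : 0 ≤ b)
    (hRe : ν ≤ U * ℓ) (h : F ≤ a * U ^ 2 / ℓ + b * ν * U / ℓ ^ 2) :
    ℓ * F ≤ (a + b) * U ^ 2 := by
  have h1 : b * ν * U / ℓ ^ 2 ≤ b * U ^ 2 / ℓ := by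
    have : b * ν * U ≤ b * (U * ℓ) * U :=
      mul_le_mul_of_nonneg_right (mul_le_mul_of_nonneg_left hRe hb) hU
    calc b * ν * U / ℓ ^ 2 ≤ b * (U * ℓ) * U / ℓ ^ 2 :=
          div_le_div_of_nonneg_right this (by positivity)
      _ = b * U ^ 2 / ℓ := by field_simp
  have h2 : F ≤ (a + b) * U ^ 2 / ℓ := by
    calc F ≤ a * U ^ 2 / ℓ + b * U ^ 2 / ℓ := by linarith
      _ = (a + b) * U ^ 2 / ℓ := by ring
  rw [le_div_iff₀ hℓ] at h2
  linarith

/-- **Lower bound on the r.m.s. velocity** (Doering–Foias 2002, §3: `U² ≳ F ℓ` at large Grashof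
number; here in the form requested by the routes). From `DoeringFoias2002_amplitude_le`: for every
shape `Φ` there is `c > 0` (namely `a + b`) such that whenever `ν ≤ U ℓ` (Reynolds number
`Re = Uℓ/ν ≥ 1`), `ℓ |F| ≤ c U²`, i.e. `U² ≥ ℓ|F|/c`. [cite: DoeringFoias2002, §3] -/
theorem DoeringFoias2002_amplitude_le.scale_mul_abs_le (h : DoeringFoias2002_amplitude_le)
    (Φ : ForcingShape (Fin 3)) :
    ∃ c : ℝ, 0 < c ∧ ∀ ⦃ν : ℝ⦄, 0 < ν → ∀ ⦃n : ℕ⦄, 0 < n →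
      ∀ (F : ℝ) (u₀ : 𝕋³ → E³) (u : ℝ → 𝕋³ → E³),
        Torus.IsGlobalLerayHopf ν (fun _ => Φ.force n F) u₀ u →
        ν ≤ rmsVelocity longTimeAvgSup u * (n : ℝ)⁻¹ →
          (n : ℝ)⁻¹ * |F| ≤ c * rmsVelocity longTimeAvgSup u ^ 2 := by
  obtain ⟨a, b, ha, hb, hab⟩ := h Φ
  refine ⟨a + b, by positivity, fun ν hν n hn F u₀ u hu hRe => ?_⟩
  exact scale_mul_le_of_amplitude_le (by positivity) (Real.sqrt_nonneg _) hb.le hRe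
    (hab hν hn F u₀ u hu)

/-- **Grashof–Reynolds form** of the amplitude bound (Doering–Foias 2002, §3): multiplying
`|F| ≤ a U²/ℓ + b ν U/ℓ²` by `ℓ³/ν²` gives `Gr ≤ a Re² + b Re` with `Gr = |F| ℓ³/ν²`
(`Turb.grashofNumber`) and `Re = U ℓ/ν` (`Turb.reynoldsNumber`). [cite: DoeringFoias2002, §3] -/
theorem DoeringFoias2002_amplitude_le.grashof_le (h : DoeringFoias2002_amplitude_le)
    (Φ : ForcingShape (Fin 3)) :
    ∃ a b : ℝ, 0 < a ∧ 0 < b ∧ ∀ ⦃ν : ℝ⦄, 0 < ν → ∀ ⦃n : ℕ⦄, 0 < n →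
      ∀ (F : ℝ) (u₀ : 𝕋³ → E³) (u : ℝ → 𝕋³ → E³),
        Torus.IsGlobalLerayHopf ν (fun _ => Φ.force n F) u₀ u →
          grashofNumber |F| (n : ℝ)⁻¹ ν ≤
            a * reynoldsNumber (rmsVelocity longTimeAvgSup u) (n : ℝ)⁻¹ ν ^ 2 +
              b * reynoldsNumber (rmsVelocity longTimeAvgSup u) (n : ℝ)⁻¹ ν := by
  obtain ⟨a, b, ha, hb, hab⟩ := h Φ
  refine ⟨a, b, ha, hb, fun ν hν n hn F u₀ u hu => ?_⟩
  have hF := hab hν hn F u₀ u hu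
  set U := rmsVelocity longTimeAvgSup u
  set ℓ : ℝ := (n : ℝ)⁻¹
  have hℓ : 0 < ℓ := by positivity
  have key : grashofNumber |F| ℓ ν = |F| * (ℓ ^ 3 / ν ^ 2) := by
    unfold grashofNumber; ring
  have rhs : a * reynoldsNumber U ℓ ν ^ 2 + b * reynoldsNumber U ℓ ν =
      (a * U ^ 2 / ℓ + b * ν * U / ℓ ^ 2) * (ℓ ^ 3 / ν ^ 2) := by
    unfold reynoldsNumber
    field_simp
  rw [key, rhs]
  exact mul_le_mul_of_nonneg_right hF (by positivity)

/-- `Re ≳ Gr^{1/2}` (Doering–Foias 2002, abstract/§3): for `Re ≥ 1`, `Gr ≤ (a + b) Re²`. [cite: DoeringFoias2002, §3] -/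
theorem DoeringFoias2002_amplitude_le.grashof_le_reynolds_sq (h : DoeringFoias2002_amplitude_le)
    (Φ : ForcingShape (Fin 3)) :
    ∃ c : ℝ, 0 < c ∧ ∀ ⦃ν : ℝ⦄, 0 < ν → ∀ ⦃n : ℕ⦄, 0 < n →
      ∀ (F : ℝ) (u₀ : 𝕋³ → E³) (u : ℝ → 𝕋³ → E³),
        Torus.IsGlobalLerayHopf ν (fun _ => Φ.force n F) u₀ u →
        1 ≤ reynoldsNumber (rmsVelocity longTimeAvgSup u) (n : ℝ)⁻¹ ν →
          grashofNumber |F| (n : ℝ)⁻¹ ν ≤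
            c * reynoldsNumber (rmsVelocity longTimeAvgSup u) (n : ℝ)⁻¹ ν ^ 2 := by
  obtain ⟨a, b, ha, hb, hab⟩ := h.grashof_le Φ
  refine ⟨a + b, by positivity, fun ν hν n hn F u₀ u hu hRe => ?_⟩
  have h1 := hab hν hn F u₀ u hu
  set R := reynoldsNumber (rmsVelocity longTimeAvgSup u) (n : ℝ)⁻¹ ν
  have hR : R ≤ R ^ 2 := by nlinarith
  nlinarith

/-- **The Doering–Foias chain** `ε ≤ ⟨f·u⟩ ≤ F U ≤ a U³/ℓ + b ν U²/ℓ²`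
(Cheskidov–Doering–Petrov 2007, eq. (20) with `α = 0`; Doering–Foias 2002, abstract): the three
named facts of this file, together with the regularity of the rescaled force
(`ForcingShape.force_regular`: `F Φ(n • x)` is smooth and mean zero, hence in `L²`), imply the
turb.S05 statement `Turb.doering_foias_bound` with `c₁ = a`, `c₂ = b`. [cite: CheskidovDoeringPetrov2006, eq. (20)] -/
theorem doering_foias_bound_of (hreg : ForcingShape.force_regular (d := Fin 3))
    (h₁ : DoeringFoias2002_dissipation_le_power) (h₂ : DoeringFoias2002_power_le)
    (h₃ : DoeringFoias2002_amplitude_le) : doering_foias_bound := by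
  intro Φ
  obtain ⟨a, b, ha, hb, hab⟩ := h₃ Φ
  refine ⟨a, b, ha, hb, fun ν hν n hn F u₀ u hu _ => ?_⟩
  obtain ⟨hsm, -, hzm⟩ := hreg Φ hn F
  have e1 := h₁ hν (hsm.memLp 2) hzm u₀ u hu
  have e2 := h₂ Φ hν hn F u₀ u hu
  have e3 := hab hν hn F u₀ u hu
  set U := rmsVelocity longTimeAvgSup u
  have hU : 0 ≤ U := Real.sqrt_nonneg _
  calc meanDissipation ν u ≤ |F| * U := e1.trans e2
    _ ≤ (a * U ^ 2 / (n : ℝ)⁻¹ + b * ν * U / (n : ℝ)⁻¹ ^ 2) * U :=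
        mul_le_mul_of_nonneg_right e3 hU
    _ = doeringFoiasRHS a b ν U (n : ℝ)⁻¹ := by
        unfold doeringFoiasRHS; ring

/-- In dimensionless form: under the three facts, `β = εℓ/U³ ≤ a + b Re⁻¹` whenever `U > 0`
(Cheskidov–Doering–Petrov 2007, eq. (20), `α = 0`). [cite: CheskidovDoeringPetrov2006, eq. (20)] -/
theorem dissipationCoeff_le_of (hreg : ForcingShape.force_regular (d := Fin 3))
    (h₁ : DoeringFoias2002_dissipation_le_power) (h₂ : DoeringFoias2002_power_le)
    (h₃ : DoeringFoias2002_amplitude_le) (Φ : ForcingShape (Fin 3)) :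
    ∃ a b : ℝ, 0 < a ∧ 0 < b ∧ ∀ ⦃ν : ℝ⦄, 0 < ν → ∀ ⦃n : ℕ⦄, 0 < n →
      ∀ (F : ℝ) (u₀ : 𝕋³ → E³) (u : ℝ → 𝕋³ → E³),
        Torus.IsGlobalLerayHopf ν (fun _ => Φ.force n F) u₀ u →
        0 < rmsVelocity longTimeAvgSup u →
          dissipationCoeff (meanDissipation ν u) (n : ℝ)⁻¹ (rmsVelocity longTimeAvgSup u) ≤
            a + b * (reynoldsNumber (rmsVelocity longTimeAvgSup u) (n : ℝ)⁻¹ ν)⁻¹ := by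
  obtain ⟨a, b, ha, hb, hab⟩ := doering_foias_bound_of hreg h₁ h₂ h₃ Φ
  refine ⟨a, b, ha, hb, fun ν hν n hn F u₀ u hu hU => ?_⟩
  have h := hab ν hν n hn F u₀ u hu hU
  set U := rmsVelocity longTimeAvgSup u
  set ℓ : ℝ := (n : ℝ)⁻¹
  have hℓ : 0 < ℓ := by positivity
  unfold dissipationCoeff reynoldsNumber
  unfold doeringFoiasRHS at h
  rw [div_le_iff₀ (by positivity)]
  have : (a + b * (U * ℓ / ν)⁻¹) * U ^ 3 = (a * U ^ 3 / ℓ + b * ν * U ^ 2 / ℓ ^ 2) * ℓ := by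
    field_simp
  rw [this]
  exact mul_le_mul_of_nonneg_right h hℓ.le

end Consequences

end Literature.Analysis.FluidPDE

end
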